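import Summits.HodgeConjecture.HodgeConjecture.Theses.EndoscopicMiddleDegree
import Literature.AlgebraicGeometry.ShimuraVarieties.SpecialCycleClasses

/-!
# `MiddleThetaSpan` (stmt-HodgeConjecture-13661) · Negative · summand 2 is decorative

Negative knowledge for the crux `EndoscopicMiddleDegree.MiddleThetaSpan` (route
EndoscopicMiddleDegree, rank 2): modulo the textbook fact that rational special cycle classes of
codimension `m` are of Hodge type `(m,m)` (Voisin I Prop. 11.20; in the tree
`isOfHodgeType_complexGysin` modulo `hodgePQ_independent_of_hodgeModel` — kept here as an explicit
HYPOTHESIS `hdiag`, nothing is assumed by stealth), the second summand `SC^m · N¹` of the crux is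
contained in the third `Hdg^{m,m}_ℚ · N¹` (`SC^m` is the complex span of its rational classes,
`specialCycleClasses_le_span_isRationalClass`). Hence the crux is the TWO-summand statement
`Hdg^{m+1,m+1}_ℚ ⊆ SC^{m+1} ⊔ Hdg^{m,m}_ℚ · N¹` (`mem_twoSummands_of_middleThetaSpan`; the converse is
trivial and is a prover's business). For refuters: a witness need only beat `SCⁿ + Hdg^{n-1,n-1}_ℚ · N¹`
(at `m = 1`: `SC² + NS · NS`, with Lefschetz (1,1) and BMM Cor. 62 for `H^{1,1}`, `p ≥ 3`).
Disprover's work file `Cruxes/MiddleThetaSpan/Disproof.lean`, finding F9. Refuter seat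
refuter-cdisprove-stmt-HodgeConjecture-13661-g2-0 (cdisprove cycle 2), 2026-08-16.
-/

noncomputable section

-- The mandated namespace `Summit.<P>.<Sub>.Theorems.…` repeats `HodgeConjecture` (single-conjunct summit).
set_option linter.dupNamespace false

namespace Summit.HodgeConjecture.HodgeConjecture.Theorems.MiddleThetaSpan.Negative.TwoSummands

open Literature.AlgebraicGeometry Literature.AlgebraicGeometry.HodgeTheory
  Literature.AlgebraicGeometry.ShimuraVarieties Literature.AlgebraicTopology.SingularHomology
open Summit.HodgeConjecture.HodgeConjecture.Theses.EndoscopicMiddleDegree (MiddleThetaSpan)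

variable {p : ℕ} {X : Motives.SchemeOver ℂ}

/-- The inlined special-cycle span of the route file is `specialCycleClasses` (the cone-repair rendering
is `rfl`). [cite: BergeronMillsonMoeglin2016Balls, Introduction §1.7] -/
theorem iSup_eq_specialCycleClasses (D : UnitaryBallQuotientDatum p X) (k : ℕ) :
    (⨆ (W : Submodule D.E (Fin (p + 1) → D.E)) (_ : IsTotallyPositive (conjRingHom D.E) D.H W)
      (_ : Module.finrank D.E W = k), classesSupportedOn X (D.specialSubvariety W) (2 * k)) =
      specialCycleClasses D k := rfl

/-- **Summand 2 ≤ summand 3** modulo the diagonal-type hypothesis: every `s ∪ d` with `s ∈ SC^m` and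
`d ∈ N¹` lies in the span of the `a ∪ d`, `a` RATIONAL of type `(m,m)`, `d ∈ N¹`.
[cite: VoisinHodgeI2002, Prop. 11.20] -/
theorem spanCup_sc_le_spanCup_ratHodge (m : ℕ) (D : UnitaryBallQuotientDatum (2 * (m + 1)) X)
    (hdiag : ∀ c ∈ specialCycleClasses D m, IsRationalClass c →
      IsOfHodgeType (2 * (m + 1)) X (2 * m) m m c) :
    Submodule.span ℂ {z : complexBetti X (2 * (m + 1)) |
        ∃ s ∈ specialCycleClasses D m, ∃ d ∈ algebraicClasses X 1,
          z = cupProduct (two_mul_add_two_mul m 1) s d} ≤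
      Submodule.span ℂ {z : complexBetti X (2 * (m + 1)) |
        ∃ a : complexBetti X (2 * m), IsRationalClass a ∧
          IsOfHodgeType (2 * (m + 1)) X (2 * m) m m a ∧
            ∃ d ∈ algebraicClasses X 1, z = cupProduct (two_mul_add_two_mul m 1) a d} := by
  refine Submodule.span_le.2 ?_
  rintro z ⟨s, hs, d, hd, rfl⟩
  -- `s` is a `ℂ`-combination of rational special classes, each of type `(m,m)` by `hdiag`
  have hs' : s ∈ Submodule.span ℂ {c : complexBetti X (2 * m) |
      IsRationalClass c ∧ c ∈ specialCycleClasses D m} :=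
    specialCycleClasses_le_span_isRationalClass D m hs
  have key : Submodule.span ℂ {c : complexBetti X (2 * m) |
      IsRationalClass c ∧ c ∈ specialCycleClasses D m} ≤
      (Submodule.span ℂ {z : complexBetti X (2 * (m + 1)) |
        ∃ a : complexBetti X (2 * m), IsRationalClass a ∧
          IsOfHodgeType (2 * (m + 1)) X (2 * m) m m a ∧
            ∃ d ∈ algebraicClasses X 1, z = cupProduct (two_mul_add_two_mul m 1) a d}).comap
        ((cupProduct (two_mul_add_two_mul m 1)).flip d) := by
    refine Submodule.span_le.2 ?_
    rintro a ⟨ha, haS⟩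
    rw [SetLike.mem_coe, Submodule.mem_comap, LinearMap.flip_apply]
    exact Submodule.subset_span ⟨a, ha, hdiag a haS ha, d, hd, rfl⟩
  simpa using key hs'

/-- **`MiddleThetaSpan` in two summands** (modulo the diagonal-type hypothesis `hdiag`): every rational
Hodge `(m+1,m+1)`-class lies in `SC^{m+1} ⊔ Hdg^{m,m}_ℚ · N¹`; summand 2 of the crux is absorbed by
summand 3. [cite: BergeronMillsonMoeglin2016Balls, Introduction Remark 3] -/
theorem mem_twoSummands_of_middleThetaSpan (h : MiddleThetaSpan)
    (hdiag : ∀ (m : ℕ) (X : Motives.SchemeOver ℂ) (D : UnitaryBallQuotientDatum (2 * (m + 1)) X),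
      ∀ c ∈ specialCycleClasses D m, IsRationalClass c →
        IsOfHodgeType (2 * (m + 1)) X (2 * m) m m c)
    (m : ℕ) (X : Motives.SchemeOver ℂ) (D : UnitaryBallQuotientDatum (2 * (m + 1)) X)
    (hm1 : 1 ≤ m) (hm2 : m ≤ 2) (c : complexBetti X (2 * (m + 1))) (hc : IsRationalClass c)
    (hH : IsOfHodgeType (2 * (m + 1)) X (2 * (m + 1)) (m + 1) (m + 1) c) :
    c ∈ specialCycleClasses D (m + 1) ⊔
      Submodule.span ℂ {z : complexBetti X (2 * (m + 1)) |
        ∃ a : complexBetti X (2 * m), IsRationalClass a ∧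
          IsOfHodgeType (2 * (m + 1)) X (2 * m) m m a ∧
            ∃ d ∈ algebraicClasses X 1, z = cupProduct (two_mul_add_two_mul m 1) a d} := by
  have hc' := h m X D hm1 hm2 c hc hH
  rw [iSup_eq_specialCycleClasses, iSup_eq_specialCycleClasses] at hc'
  obtain ⟨y, hy, w, hw, rfl⟩ := Submodule.mem_sup.1 hc'
  obtain ⟨u, hu, v, hv, rfl⟩ := Submodule.mem_sup.1 hy
  exact Submodule.add_mem _ (Submodule.add_mem _ (Submodule.mem_sup_left hu)
    (Submodule.mem_sup_right (spanCup_sc_le_spanCup_ratHodge m D (hdiag m X D) hv)))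
    (Submodule.mem_sup_right hw)

end Summit.HodgeConjecture.HodgeConjecture.Theorems.MiddleThetaSpan.Negative.TwoSummands

end
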